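import Mathlib
import Literature.Analysis.UnboundedOperators.HeatKernelHeatEquation
import Literature.Analysis.UnboundedOperators.HeatGradientSmoothing
import Literature.Analysis.UnboundedOperators.HeatFlowCalculus
import HarnessLib

/-!
# `L²` bounds on the gradient of the 1-D caloric extension (stub `stub_heatGradientL2Line`)

Crux `MarginalStabilityChain.StrainedLayerLaw` (stmt-AnomalousDissipation-3007), line
`FirstLemmasR2K4`, parallel-relaxation package. For `g ∈ C²_c(ℝ)`, `σ > 0` and the caloric
extension `e^{σΔ} g = heatExtension g σ` on the real line (`E = F = ℝ`):

* **contraction of the gradient**: `x ↦ ((e^{σΔ}g)'(x))²` is integrable and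
  `∫ ((e^{σΔ}g)')² ≤ ∫ (g')²` — derivatives fall on compactly supported data,
  `(e^{σΔ}g)' = e^{σΔ}(g')` (`fderiv_heatExtension_apply_of_hasCompactSupport`), and `e^{σΔ}` is an
  `L²` contraction (`eLpNorm_heatExtension_le_holds`, Young + `‖G_σ‖₁ = 1`);
* **`L¹ → L²` smoothing of the gradient**: there is `C ≥ 0` with
  `∫ ((e^{σΔ}g)')² ≤ C σ^{-3/2} (∫ |g|)²` — the instance `(n, p, q) = (1, 1, 2)` of
  `‖∇e^{tΔ}f‖_q ≤ C t^{-1/2-(n/2)(1/p-1/q)} ‖f‖_p` (`eLpNorm_fderiv_heatExtension_le_rpow`,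
  Giga–Giga–Saal 2010, §1.1.3), squared.
-/

noncomputable section

open scoped Topology ENNReal NNReal
open Filter Set Function MeasureTheory

set_option linter.dupNamespace false

namespace Summit.AnomalousDissipation.AnomalousDissipation.Theorems.StrainedLayerLaw.ParallelRelax

open Literature.Analysis.UnboundedOperators

/-- Derivatives fall on the data, 1-D form: `(e^{σΔ} g)' = e^{σΔ}(g')` for `g ∈ C¹_c(ℝ)` and
every `σ`. [folklore] -/
theorem deriv_heatExtension_of_hasCompactSupport_line {g : ℝ → ℝ} (hg : ContDiff ℝ 1 g)
    (hc : HasCompactSupport g) (σ : ℝ) :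
    deriv (heatExtension g σ) = heatExtension (deriv g) σ := by
  funext x
  rw [← fderiv_apply_one_eq_deriv, fderiv_heatExtension_apply_of_hasCompactSupport hg hc σ x 1]
  rfl

/-- `‖h‖_{L²(ℝ)} = ofReal √(∫ h²)` for a.e.-strongly measurable real `h` with `∫ h² < ∞`.
[folklore] -/
theorem eLpNorm_two_eq_ofReal_sqrt_line {f : ℝ → ℝ} (hf : AEStronglyMeasurable f volume)
    (hf2 : Integrable (fun x => f x ^ 2)) :
    eLpNorm f 2 volume = ENNReal.ofReal (Real.sqrt (∫ x, f x ^ 2)) := by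
  -- adapted from Literature/Analysis/Calculus/ExteriorSobolev.lean (`eLpNorm_two_eq_ofReal_sqrt`)
  have hmem : MemLp f 2 volume := (memLp_two_iff_integrable_sq hf).2 hf2
  rw [hmem.eLpNorm_eq_integral_rpow_norm two_ne_zero ENNReal.ofNat_ne_top]
  simp only [ENNReal.toReal_ofNat, Real.rpow_two, sq_abs, Real.norm_eq_abs]
  rw [Real.sqrt_eq_rpow, show ((2 : ℝ))⁻¹ = 1 / 2 by norm_num]

/-- `‖h‖_{L¹(ℝ)} = ofReal (∫ |h|)` for integrable real `h`. [folklore] -/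
theorem eLpNorm_one_eq_ofReal_integral_abs_line {f : ℝ → ℝ} (hf : Integrable f) :
    eLpNorm f 1 volume = ENNReal.ofReal (∫ x, |f x|) := by
  rw [eLpNorm_one_eq_lintegral_enorm, ← ofReal_integral_norm_eq_lintegral_enorm hf]
  simp only [Real.norm_eq_abs]

/-- **`L²` contraction of the gradient of the 1-D caloric extension**: for `g ∈ C²_c(ℝ)` and
`0 < σ`, `x ↦ ((e^{σΔ}g)'(x))²` is integrable and `∫ ((e^{σΔ}g)')² ≤ ∫ (g')²`. [folklore] -/
theorem integrable_sq_deriv_heatExtension_and_integral_le {g : ℝ → ℝ} (hg : ContDiff ℝ 2 g)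
    (hc : HasCompactSupport g) {σ : ℝ} (hσ : 0 < σ) :
    Integrable (fun x => deriv (heatExtension g σ) x ^ 2) ∧
      ∫ x, deriv (heatExtension g σ) x ^ 2 ≤ ∫ x, deriv g x ^ 2 := by
  have hg1 : ContDiff ℝ 1 g := hg.of_le one_le_two
  have hD : deriv (heatExtension g σ) = heatExtension (deriv g) σ :=
    deriv_heatExtension_of_hasCompactSupport_line hg1 hc σ
  have hg'c : Continuous (deriv g) := hg1.continuous_deriv_one
  have hg's : HasCompactSupport (deriv g) := hc.deriv
  have hmem : MemLp (deriv g) 2 volume := hg'c.memLp_of_hasCompactSupport hg's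
  have hmemE : MemLp (heatExtension (deriv g) σ) 2 volume :=
    memLp_heatExtension_holds hmem one_le_two hσ
  have hle : eLpNorm (heatExtension (deriv g) σ) 2 volume ≤ eLpNorm (deriv g) 2 volume :=
    eLpNorm_heatExtension_le_holds hmem one_le_two hσ
  have hint' : Integrable (fun x => deriv g x ^ 2) := (memLp_two_iff_integrable_sq hmem.1).1 hmem
  have hintE : Integrable (fun x => heatExtension (deriv g) σ x ^ 2) :=
    (memLp_two_iff_integrable_sq hmemE.1).1 hmemE
  rw [hD]
  refine ⟨hintE, ?_⟩
  rw [eLpNorm_two_eq_ofReal_sqrt_line hmemE.1 hintE, eLpNorm_two_eq_ofReal_sqrt_line hmem.1 hint',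
    ENNReal.ofReal_le_ofReal_iff (Real.sqrt_nonneg _)] at hle
  exact (Real.sqrt_le_sqrt_iff (integral_nonneg fun x => sq_nonneg _)).1 hle

/-- **`L¹ → L²` smoothing of the gradient of the 1-D caloric extension**: there is `C ≥ 0` such
that `∫ ((e^{σΔ}g)')² ≤ C σ^{-3/2} (∫ |g|)²` for all `g ∈ C²_c(ℝ)` and `0 < σ`
(Giga–Giga–Saal 2010, §1.1.3, case `n = 1`, `p = 1`, `q = 2`, squared). [folklore] -/
theorem exists_integral_sq_deriv_heatExtension_le_rpow :
    ∃ C : ℝ, 0 ≤ C ∧ ∀ (g : ℝ → ℝ) (σ : ℝ), ContDiff ℝ 2 g → HasCompactSupport g → 0 < σ →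
      ∫ x, deriv (heatExtension g σ) x ^ 2 ≤ C * σ ^ (-(3 / 2 : ℝ)) * (∫ x, |g x|) ^ 2 := by
  obtain ⟨C, hC⟩ :=
    eLpNorm_fderiv_heatExtension_le_rpow (E := ℝ) (F := ℝ) (p := 1) (q := 2) le_rfl one_le_two
  refine ⟨(C : ℝ) ^ 2, sq_nonneg _, fun g σ hg hc hσ => ?_⟩
  have hmem1 : MemLp g 1 volume := hg.continuous.memLp_of_hasCompactSupport hc
  have hgi : Integrable g := memLp_one_iff_integrable.1 hmem1
  have h := hC g hmem1 σ hσ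
  -- the exponent `-1/2 - (1/2)(1 - 1/2) = -3/4`
  have hexp : (-(1 / 2 : ℝ) - ((Module.finrank ℝ ℝ : ℝ) / 2) *
      ((1 / (1 : ℝ≥0∞)).toReal - (1 / (2 : ℝ≥0∞)).toReal)) = -(3 / 4 : ℝ) := by
    rw [Module.finrank_self]
    norm_num
  rw [hexp] at h
  -- `‖∇ u‖_{L²} = ‖u'‖_{L²}`
  have hnorm : eLpNorm (fderiv ℝ (heatExtension g σ)) 2 volume =
      eLpNorm (deriv (heatExtension g σ)) 2 volume :=
    eLpNorm_congr_norm_ae (Eventually.of_forall fun x => (norm_deriv_eq_norm_fderiv).symm)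
  obtain ⟨hint, -⟩ := integrable_sq_deriv_heatExtension_and_integral_le hg hc hσ
  have hDm : AEStronglyMeasurable (deriv (heatExtension g σ)) volume :=
    ((contDiff_heatExtension_of_hasCompactSupport hg hc σ).continuous_deriv one_le_two).aestronglyMeasurable
  rw [hnorm, eLpNorm_two_eq_ofReal_sqrt_line hDm hint, eLpNorm_one_eq_ofReal_integral_abs_line hgi,
    ← ENNReal.ofReal_coe_nnreal, ← ENNReal.ofReal_mul C.coe_nonneg,
    ← ENNReal.ofReal_mul (mul_nonneg C.coe_nonneg (Real.rpow_nonneg hσ.le _)),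
    ENNReal.ofReal_le_ofReal_iff
      (mul_nonneg (mul_nonneg C.coe_nonneg (Real.rpow_nonneg hσ.le _))
        (integral_nonneg fun x => abs_nonneg _))] at h
  set A := ∫ x, deriv (heatExtension g σ) x ^ 2 with hA
  have hA0 : 0 ≤ A := integral_nonneg fun x => sq_nonneg _
  have hsq : A = Real.sqrt A ^ 2 := (Real.sq_sqrt hA0).symm
  have hpow : σ ^ (-(3 / 2 : ℝ)) = (σ ^ (-(3 / 4 : ℝ))) ^ 2 := by
    rw [← Real.rpow_two, ← Real.rpow_mul hσ.le]
    norm_num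
  calc A = Real.sqrt A ^ 2 := hsq
    _ ≤ ((C : ℝ) * σ ^ (-(3 / 4 : ℝ)) * ∫ x, |g x|) ^ 2 :=
        pow_le_pow_left₀ (Real.sqrt_nonneg _) h 2
    _ = (C : ℝ) ^ 2 * σ ^ (-(3 / 2 : ℝ)) * (∫ x, |g x|) ^ 2 := by rw [hpow]; ring

/-- **Stub `stub_heatGradientL2Line`** (registered sub-goal of the parallel-relaxation package):
(1) `L²` contraction of the gradient of the 1-D caloric extension of `C²_c` data and
(2) `L¹ → L²` smoothing of that gradient with rate `σ^{-3/2}`. [folklore] -/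
theorem stub_heatGradientL2Line :
    (∀ (g : ℝ → ℝ) (σ : ℝ), ContDiff ℝ 2 g → HasCompactSupport g → 0 < σ →
      Integrable (fun x => deriv (heatExtension g σ) x ^ 2) ∧
      ∫ x, deriv (heatExtension g σ) x ^ 2 ≤ ∫ x, deriv g x ^ 2) ∧
    (∃ C : ℝ, 0 ≤ C ∧ ∀ (g : ℝ → ℝ) (σ : ℝ), ContDiff ℝ 2 g → HasCompactSupport g → 0 < σ →
      ∫ x, deriv (heatExtension g σ) x ^ 2 ≤ C * σ ^ (-(3 / 2 : ℝ)) * (∫ x, |g x|) ^ 2) :=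
  ⟨fun _ _ hg hc hσ => integrable_sq_deriv_heatExtension_and_integral_le hg hc hσ,
    exists_integral_sq_deriv_heatExtension_le_rpow⟩

end Summit.AnomalousDissipation.AnomalousDissipation.Theorems.StrainedLayerLaw.ParallelRelax
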